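import Summits.Ventures.PercRepro.C025ProfileTwoFlatModel

/-!
# C-025 AT EVERY `(p, q)` ON THE TWO-FLAT MODEL, MODULO THE ARITHMETIC CORE (night-3 g26)

`proofs/NIGHT3-G26-TWOFLATS.md` §5′.  The rank of the two-flat model `T_r(U_{s₁,F₁} ⊕ U_{s₂,F₂} ⊕ U_{m,m})` is at most
`r` (`twoFlatModel_eRank_le`), so above `r` the rank level-set inequality is vacuous (`ThmN.RLS_of_eRank_lt`) and below
it is `rls_twoFlatModel_of_arith`: **the body of `C025` at EVERY `(p, q)` on the model** follows from the two-flat arithmetic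
core (TF) at the rows `q < u < p` (`rls_twoFlatModel_all_pq_of_arith`) — no condition on `p`, `q`, `#F₁`, `#F₂`, the free
part or `r`.  (TF) remains the one open obligation.  No `def`, no `instance`, no notation.  Axioms: standard.
-/

open scoped Matroid

namespace PercRepro

open Finset ThmH

namespace TwoFlat

variable {α : Type} [DecidableEq α]

variable {E₁ E₂ : Set α} (hE₁ : E₁.Finite) (hE₂ : E₂.Finite) (F₁ F₂ : Set α) (s₁ s₂ : ℕ)
  (h : Disjoint (modelMatroid hE₁ F₁ s₁ (s₁ + (E₁ \ F₁).ncard)).E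
    (modelMatroid hE₂ F₂ s₂ (s₂ + (E₂ \ F₂).ncard)).E) (r : ℕ)

omit [DecidableEq α] in
/-- The rank of the two-flat model is at most `r`. -/
theorem twoFlatModel_eRank_le :
    haveI := disjointSum_models_finite hE₁ hE₂ F₁ F₂ s₁ s₂ h
    (Matroid.truncate ((modelMatroid hE₁ F₁ s₁ (s₁ + (E₁ \ F₁).ncard)).disjointSum
      (modelMatroid hE₂ F₂ s₂ (s₂ + (E₂ \ F₂).ncard)) h) r).eRank ≤ (r : ℕ∞) := by
  haveI := disjointSum_models_finite hE₁ hE₂ F₁ F₂ s₁ s₂ h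
  rw [Matroid.truncate_eRank]
  exact min_le_right _ _

open Classical in
/-- **C-025 AT EVERY `(p, q)`, WITHOUT EXCEPTION, ON THE TWO-FLAT MODEL, MODULO (TF)** at the rows `q < u < p`: for
`p ≤ r` by `rls_twoFlatModel_of_arith`, for `p > r` vacuously (no set of rank `p`). -/
theorem rls_twoFlatModel_all_pq_of_arith (hF₁ : F₁ ⊆ E₁) (hF₂ : F₂ ⊆ E₂) (p q : ℕ)
    (hTF : ∀ u : ℕ, q < u → u < p →
      ∑ i₁ ∈ range (F₁.ncard + 1), ∑ i₂ ∈ range (F₂.ncard + 1),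
        F₁.ncard.choose i₁ * F₂.ncard.choose i₂ *
          (if min i₁ s₁ + min i₂ s₂ ≤ q ∧
              u ≤ min (F₁.ncard - i₁) s₁ + min (F₂.ncard - i₂) s₂ +
                (((E₁ ∪ E₂) \ (F₁ ∪ F₂)).ncard - (q - min i₁ s₁ - min i₂ s₂)) then
            ((E₁ ∪ E₂) \ (F₁ ∪ F₂)).ncard.choose (q - min i₁ s₁ - min i₂ s₂) *
              (min (F₁.ncard - i₁) s₁ + min (F₂.ncard - i₂) s₂ +
                (((E₁ ∪ E₂) \ (F₁ ∪ F₂)).ncard - (q - min i₁ s₁ - min i₂ s₂))).choose (u - q)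
          else 0) ≤
      u.choose q * ∑ j₁ ∈ range (F₁.ncard + 1), ∑ j₂ ∈ range (F₂.ncard + 1),
        F₁.ncard.choose j₁ * F₂.ncard.choose j₂ *
          (if min j₁ s₁ + min j₂ s₂ ≤ u then
            ((E₁ ∪ E₂) \ (F₁ ∪ F₂)).ncard.choose (u - min j₁ s₁ - min j₂ s₂) else 0)) :
    haveI := disjointSum_models_finite hE₁ hE₂ F₁ F₂ s₁ s₂ h
    ThmN.RLS (Matroid.truncate ((modelMatroid hE₁ F₁ s₁ (s₁ + (E₁ \ F₁).ncard)).disjointSum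
      (modelMatroid hE₂ F₂ s₂ (s₂ + (E₂ \ F₂).ncard)) h) r) p q := by
  haveI := disjointSum_models_finite hE₁ hE₂ F₁ F₂ s₁ s₂ h
  by_cases hpr : p ≤ r
  · exact rls_twoFlatModel_of_arith hE₁ hE₂ F₁ F₂ s₁ s₂ h r hF₁ hF₂ p q hpr hTF
  · apply ThmN.RLS_of_eRank_lt
    calc (Matroid.truncate ((modelMatroid hE₁ F₁ s₁ (s₁ + (E₁ \ F₁).ncard)).disjointSum
          (modelMatroid hE₂ F₂ s₂ (s₂ + (E₂ \ F₂).ncard)) h) r).eRank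
        ≤ (r : ℕ∞) := twoFlatModel_eRank_le hE₁ hE₂ F₁ F₂ s₁ s₂ h r
      _ < (p : ℕ∞) := by exact_mod_cast (by omega : r < p)

end TwoFlat

end PercRepro
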